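import Literature.NumberTheory.EllipticCurves.RingClassFieldInertiaGenerator
import Literature.NumberTheory.EllipticCurves.AnticyclotomicTowerSharpOfSplittingProofs
import Literature.NumberTheory.GaloisRepresentations.DecompositionGroupOfCompletion
import Literature.NumberTheory.GaloisRepresentations.IdeleLocalPairDecomposition
import Literature.NumberTheory.GaloisRepresentations.LocalGaloisGroupFrobeniusProofs
import Literature.NumberTheory.GaloisRepresentations.LocalGaloisGroupProofs
import Literature.NumberTheory.GaloisCohomology.Howard2004.TransverseUnramifiedDisjointProofs
import HarnessLib

/-!
# At an inert prime `λ = (ℓ)` of an imaginary quadratic `K`, a Frobenius of `K_λ` acts on `K[ℓ]` through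
# the inertia group: `Frob_λ ∈ I_{K_λ} · (Γ_{K_λ} ∩ Γ_{K[ℓ]})` (proofs file)

Topic `NumberTheory/GaloisCohomology/Howard2004` (discharge of the «totally ramified» hypothesis `hφΛ` of
`Howard2004/TransverseUnramifiedDisjointProofs` — the disjointness half `H¹_f(K_λ,T) ∩ H¹_tr(K_λ,T) = 0` of
Howard 2004 Prop. 1.1.9 — from the class field theory of ring class fields already in the tree).  THEOREMS
ONLY: no definition, no named fact, no instance, no `sorry`.

B. Howard, *The Heegner point Kolyvagin system*, Compositio Math. 140 (2004) §1.2 (arXiv:1202.6340 p. 6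
L84–95): «For `ℓ ∣ λ ∈ 𝓛₀` we denote by `K[ℓ]` the ring class field of conductor `ℓ`.  Since `λ` splits
completely in the Hilbert class field of `K`, the maximal `p`-subextension of the local extension `K[ℓ]_λ/K_λ`
… is a maximal totally tamely ramified abelian `p`-extension of `K_λ`».  Gross 1991 §3 (proof of Prop. 3.7):
«the prime `λ` … splits completely in `K_1/K`»; «the factors `λ_1` of `λ` in `K_1` are totally ramified in
`K_ℓ`».  In Galois terms at the completion: the decomposition group of `λ` acts on `K[ℓ]` through
`Gal(K[ℓ]/K[1])`, onto which the inertia group SURJECTS — so every Frobenius element of `Γ_{K_λ}` agrees on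
`K[ℓ]` with an inertia element.

* **`exists_isFrobPow_one_and_inv_mul_mem_localRingClassSubgroup`** — for `K` imaginary quadratic, `ℓ` a
  rational prime with `(ℓ)` prime in `𝓞_K` and `λ ∋ ℓ`: there are an arithmetic Frobenius `φ ∈ Γ_{K_λ}`
  (`IsFrobPow φ 1`) and `τ ∈ I_{K_λ}` with `τ⁻¹φ ∈ localRingClassSubgroup ℓ jbar λ = Γ_{K_λ} ∩ Γ_{K[ℓ]}`
  — VERBATIM the hypothesis `hφΛ` of `disjoint_unramifiedSubgroup_transverseCondition_of_isFrobPow` /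
  `SelmerTriple.disjoint_cond_transverseStructure_of_isFrobPow`; indeed EVERY arithmetic Frobenius has such a
  `τ` (`exists_mem_absInertia_inv_mul_mem_localRingClassSubgroup_of_isAbsArithFrob`).
  Proof: `res φ` is an arithmetic Frobenius at the prime `𝔓₀` of `\bar ℤ_K` cut out by `K̄ → \bar K_λ`
  (`isArithFrobAt_absGaloisRestrict_adicCompletionPrime_iff`); it fixes `K[1]` inside any class-field copy
  `R ≅ K[ℓ]` in `K̄` (`RingClassFieldInertiaGenerator`, §4: «`λ` splits completely in `K_m`»), so restricts to an
  element of `Gal(K[ℓ]/K[1])`, which LIFTS to `τ' ∈ I_{𝔓₀}` (§2: «each prime factor of `ℓ` in `K_m` ramifies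
  totally in `K_n`»); `I_{𝔓₀} = res I_{K_λ}` (`inertia_adicCompletionPrime_eq_map_absInertia`) gives `τ`, and
  `res(τ⁻¹φ)` fixes `R` pointwise, i.e. lies in `ringClassSubgroup K ℓ jbar` (`mem_ringClassSubgroup_iff_forall_smul_eq`).
* §2 **`disjoint_unramifiedSubgroup_transverseCondition_of_isImaginaryQuadratic`**,
  **`SelmerTriple.disjoint_cond_transverseStructure_of_isImaginaryQuadratic`** — hence, UNCONDITIONALLY at an
  inert prime of an imaginary quadratic field (trivial local action on `T`): `H¹_f(K_λ, T) ∩ H¹_tr(K_λ, T) = 0`,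
  i.e. the hypothesis `hdisj` of `SelmerStructureModifyOnePlaceProofs` / the (ks)-relation reading, `hdis` of
  the parity count and `hc.1` of the Lagrangian algebra, discharged.

Cell `pub/bsd-print-x9`, G87 = Howard 2004 Thm. 1.6.1 (print leaf `stub_h161` of stmt-BirchSwinnertonDyer-22642);
seat `bsd-line-x9-p1-w3` g14, brick (SPLIT-FROB).  BSD is not proved by any of this.

References: [Howard2004HeegnerKolyvagin] §1.2 (arXiv:1202.6340 p. 6 L84–95); [GrossLMS1991] B. H. Gross, LMS LNS 153
(1991) §3, proof of Prop. 3.7; [McCallumLMS1991] §4; [Cox2013] Thm. 11.1; [NeukirchANT1999] Ch. II §9 (9.6).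
-/

set_option autoImplicit false

noncomputable section

open scoped Classical NumberField Pointwise
open NumberField IsDedekindDomain IsDedekindDomain.HeightOneSpectrum Field

namespace Literature.NumberTheory.GaloisCohomology.Howard2004

open Literature.NumberTheory.GaloisRepresentations
open Literature.NumberTheory.GaloisRepresentations.IsNonarchimedeanLocalField
open Literature.NumberTheory.EllipticCurves

variable {K : Type} [Field K] [NumberField K]

/-- **Every arithmetic Frobenius of `K_λ` is an inertia element times an element fixing `K[ℓ]`** (`K`
imaginary quadratic, `(ℓ)` an inert rational prime, `λ ∋ ℓ`): for `φ ∈ Γ_{K_λ}` with `IsAbsArithFrob φ` there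
is `τ ∈ I_{K_λ}` with `τ⁻¹ φ ∈ localRingClassSubgroup ℓ jbar λ` — the decomposition group of `λ` acts on
`K[ℓ]` through `Gal(K[ℓ]/K[1])` («`λ` splits completely in `K[1]`») onto which inertia surjects («`K[ℓ]/K[1]`
totally ramified at `λ`»).
[cite: GrossLMS1991, §3 (proof of Prop. 3.7 (2))] [cite: Howard2004HeegnerKolyvagin, §1.2 (arXiv:1202.6340 p. 6 L84–95)] -/
theorem exists_mem_absInertia_inv_mul_mem_localRingClassSubgroup_of_isAbsArithFrob
    (hK : IsImaginaryQuadratic K) (jbar : AlgebraicClosure K →+* ℂ) {ℓ : ℕ} (hℓ : ℓ.Prime)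
    (hℓP : (Ideal.span {(ℓ : 𝓞 K)}).IsPrime) {v : HeightOneSpectrum (𝓞 K)} (hv : (ℓ : 𝓞 K) ∈ v.asIdeal)
    {φ : absoluteGaloisGroup (v.adicCompletion K)} (hφ : IsAbsArithFrob φ) :
    ∃ τ ∈ absInertia (v.adicCompletion K), τ⁻¹ * φ ∈ localRingClassSubgroup ℓ jbar v := by
  set ι : K →+* ℂ := jbar.comp (algebraMap K (AlgebraicClosure K)) with hι
  have hℓ1 : ℓ * 1 ≠ 0 := by rw [mul_one]; exact hℓ.ne_zero
  -- a class-field copy `R ≅ K[ℓ]` of the ring class field inside `K̄`, and the embedding `emb : K[ℓ] → K̄`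
  obtain ⟨R, hfd, hgal, -, -, ⟨e⟩⟩ := exists_classField_algEquiv_ringClassField hK ι hℓ1
  haveI := hfd
  haveI := hgal
  set emb : ringClassField K ι (ℓ * 1) →+* AlgebraicClosure K :=
    (R.val : R →ₐ[K] AlgebraicClosure K).toRingHom.comp e.symm.toAlgHom.toRingHom with hemb_def
  have hemb_apply : ∀ x, emb x = ((e.symm x : R) : AlgebraicClosure K) := fun _ => rfl
  have hemb : ∀ k : K, emb (algebraMap K (ringClassField K ι (ℓ * 1)) k) =
      algebraMap K (AlgebraicClosure K) k := fun k => by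
    rw [hemb_apply, AlgEquiv.commutes]; rfl
  -- the prime `𝔓₀` of the completion; `res φ` is an arithmetic Frobenius there
  have h𝔓₀ := adicCompletionPrime_mem_primesAbove K v
  set F : absoluteGaloisGroup K := absGaloisRestrict K (v.adicCompletion K) φ with hF_def
  have hF : IsArithFrobAt (𝓞 K) F (adicCompletionPrime K v) :=
    (isArithFrobAt_absGaloisRestrict_adicCompletionPrime_iff K v
      (IdeleCohomology.residueFieldCard_adicCompletion_eq_card_quotient v) φ).2 hφ
  -- `F` fixes `K[1]` inside `emb(K[ℓ])`
  have hfix1 : ∀ x : ringClassField K ι (ℓ * 1), (x : ℂ) ∈ ringClassField K ι 1 →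
      (show AlgebraicClosure K ≃ₐ[K] AlgebraicClosure K from F) (emb x) = emb x := fun x hx =>
    apply_emb_eq_self_of_isArithFrobAt_of_mem_ringClassField hK ι hℓ one_ne_zero hℓ.not_dvd_one hv hℓP
      emb hemb h𝔓₀ hF hx
  -- restrict `F` to `R ≅ K[ℓ]`: an automorphism `σ` of `K[ℓ]` fixing `K[1]`, with `F ∘ emb = emb ∘ σ`
  let F' : AlgebraicClosure K ≃ₐ[K] AlgebraicClosure K := F
  let σK : ringClassField K ι (ℓ * 1) ≃ₐ[K] ringClassField K ι (ℓ * 1) :=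
    e.symm.trans ((F'.restrictNormal R).trans e)
  have hσK : ∀ x, emb (σK x) = F' (emb x) := fun x => by
    rw [hemb_apply, hemb_apply]
    change (((e.symm (e (F'.restrictNormal R (e.symm x)))) : R) : AlgebraicClosure K) = _
    rw [AlgEquiv.symm_apply_apply, AlgEquiv.restrictNormal_apply]
  let σ : ringClassField K ι (ℓ * 1) ≃ₐ[ℚ] ringClassField K ι (ℓ * 1) := σK.restrictScalars ℚ
  have hσ_apply : ∀ x, σ x = σK x := fun _ => rfl
  have hσmem : σ ∈ ringClassGalOver ι (ℓ * 1) 1 := by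
    refine (mem_fixingSubgroup_iff _).2 fun x hx => ?_
    change σ x = x
    rw [hσ_apply]
    apply emb.injective
    rw [hσK]
    exact hfix1 x hx
  -- lift `σ` to the inertia group `I_{𝔓₀}`, then to the local inertia group
  obtain ⟨τ', hτ'I, hτ'⟩ := exists_mem_inertia_apply_emb_eq_of_mem_ringClassGalOver hK ι hℓ one_ne_zero
    hℓ.not_dvd_one hv hℓP emb hemb h𝔓₀ hσmem
  rw [inertia_adicCompletionPrime_eq_map_absInertia] at hτ'I
  obtain ⟨τ, hτ, hττ'⟩ := Subgroup.mem_map.1 hτ'I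
  refine ⟨τ, hτ, ?_⟩
  -- `res (τ⁻¹ φ) = τ'⁻¹ F` fixes `R` pointwise
  change absGaloisRestrict K (v.adicCompletion K) (τ⁻¹ * φ) ∈ ringClassSubgroup K ℓ jbar
  have hres : absGaloisRestrict K (v.adicCompletion K) (τ⁻¹ * φ) = τ'⁻¹ * F := by
    rw [map_mul, map_inv, ← hF_def]
    exact congrArg (fun g => g⁻¹ * F) hττ'
  rw [hres]
  have key : τ'⁻¹ * F ∈ ringClassSubgroup K (ℓ * 1) jbar := by
    refine (mem_ringClassSubgroup_iff_forall_smul_eq hK jbar hℓ1 e (τ'⁻¹ * F)).2 fun y hy => ?_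
    -- `y = emb x` with `x = e ⟨y, hy⟩`
    have hyx : emb (e ⟨y, hy⟩) = y := by rw [hemb_apply, AlgEquiv.symm_apply_apply]
    rw [← hyx, mul_smul]
    have h1 : F • emb (e ⟨y, hy⟩) = τ' • emb (e ⟨y, hy⟩) := by
      rw [Field.absoluteGaloisGroup.smul_def, Field.absoluteGaloisGroup.smul_def]
      change F' (emb (e ⟨y, hy⟩)) = (show AlgebraicClosure K ≃ₐ[K] AlgebraicClosure K from τ') _
      rw [← hσK, hτ' (e ⟨y, hy⟩)]
      rfl
    rw [h1, inv_smul_smul]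
  simpa only [mul_one] using key

/-- **There is an arithmetic Frobenius `φ` of `K_λ` (`IsFrobPow φ 1`) and `τ ∈ I_{K_λ}` with
`τ⁻¹φ ∈ Γ_{K_λ} ∩ Γ_{K[ℓ]}`** (`K` imaginary quadratic, `(ℓ)` an inert rational prime, `λ ∋ ℓ`) — VERBATIM
the hypothesis `hφΛ` of `Howard2004/TransverseUnramifiedDisjointProofs`
(`disjoint_unramifiedSubgroup_transverseCondition_of_isFrobPow`,
`SelmerTriple.disjoint_cond_transverseStructure_of_isFrobPow`): with it, `H¹_f(K_λ, T) ∩ H¹_tr(K_λ, T) = 0`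
for every `T` with trivial `Γ_{K_λ}`-action.
[cite: GrossLMS1991, §3 (proof of Prop. 3.7 (2))] [cite: Howard2004HeegnerKolyvagin, Prop. 1.1.9 and §1.2 (arXiv:1202.6340 p. 6)] -/
theorem exists_isFrobPow_one_and_inv_mul_mem_localRingClassSubgroup
    (hK : IsImaginaryQuadratic K) (jbar : AlgebraicClosure K →+* ℂ) {ℓ : ℕ} (hℓ : ℓ.Prime)
    (hℓP : (Ideal.span {(ℓ : 𝓞 K)}).IsPrime) {v : HeightOneSpectrum (𝓞 K)} (hv : (ℓ : 𝓞 K) ∈ v.asIdeal) :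
    ∃ φ : absoluteGaloisGroup (v.adicCompletion K), IsFrobPow φ 1 ∧
      ∃ τ ∈ absInertia (v.adicCompletion K), τ⁻¹ * φ ∈ localRingClassSubgroup ℓ jbar v := by
  obtain ⟨φ, hφ⟩ := exists_isAbsArithFrob_holds (F := v.adicCompletion K)
  exact ⟨φ, IsAbsArithFrob.isFrobPow_holds hφ,
    exists_mem_absInertia_inv_mul_mem_localRingClassSubgroup_of_isAbsArithFrob hK jbar hℓ hℓP hv hφ⟩

/-! ## §2 `H¹_f(K_λ, T) ∩ H¹_tr(K_λ, T) = 0` at an inert prime, unconditionally -/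

section Disjoint

variable {M : Type} [AddCommGroup M] [TopologicalSpace M] [DiscreteTopology M] (p : ℕ) [Fact p.Prime]

/-- **Howard Prop. 1.1.9, disjointness half, at an inert prime of an imaginary quadratic field**: for `K`
imaginary quadratic, `(ℓ)` an inert rational prime, `λ ∋ ℓ`, and a discrete `Γ_K`-module `T` on which
`Γ_{K_λ}` acts trivially, `H¹_f(K_λ, T) ∩ H¹_tr(K_λ, T) = 0` (`H¹_tr` = Howard's transverse condition cut out by
`K[ℓ]`).  (`…_of_isFrobPow` of `TransverseUnramifiedDisjointProofs` + the Frobenius of §1.)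
[cite: Howard2004HeegnerKolyvagin, Prop. 1.1.9 and §1.2 (arXiv:1202.6340 p. 6 L17–25, L84–95)]
[cite: GrossLMS1991, §3 (proof of Prop. 3.7 (2))] -/
theorem disjoint_unramifiedSubgroup_transverseCondition_of_isImaginaryQuadratic
    (hK : IsImaginaryQuadratic K) (ρ : DiscreteGaloisModule K M) (jbar : AlgebraicClosure K →+* ℂ) {ℓ : ℕ}
    (hℓ : ℓ.Prime) (hℓP : (Ideal.span {(ℓ : 𝓞 K)}).IsPrime) {v : HeightOneSpectrum (𝓞 K)}
    (hv : (ℓ : 𝓞 K) ∈ v.asIdeal)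
    (htriv : ∀ (g : absoluteGaloisGroup (v.adicCompletion K)) (x : M), GaloisRep.toLocal v ρ g x = x) :
    Disjoint (DiscreteGaloisModule.unramifiedSubgroup (GaloisRep.toLocal v ρ) 1)
      (transverseCondition p ρ ℓ jbar v) := by
  obtain ⟨φ, hφ, hφΛ⟩ := exists_isFrobPow_one_and_inv_mul_mem_localRingClassSubgroup hK jbar hℓ hℓP hv
  exact disjoint_unramifiedSubgroup_transverseCondition_of_isFrobPow p ρ ℓ jbar v htriv hφ hφΛ

omit [NumberField K] in
/-- The residue characteristic of `λ` lies in `λ`. [folklore] -/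
private theorem natCast_residueChar_mem (v : HeightOneSpectrum (𝓞 K)) :
    ((residueChar v : ℕ) : 𝓞 K) ∈ v.asIdeal := by
  rw [← Ideal.Quotient.eq_zero_iff_mem, map_natCast]
  exact ringChar.Nat.cast_ringChar

/-- The residue characteristic of `λ` is a prime number. [folklore] -/
private theorem residueChar_prime (v : HeightOneSpectrum (𝓞 K)) : (residueChar v).Prime := by
  haveI : Finite (𝓞 K ⧸ v.asIdeal) := v.asIdeal.finiteQuotientOfFreeOfNeBot v.ne_bot
  letI : Field (𝓞 K ⧸ v.asIdeal) := Ideal.Quotient.field _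
  unfold residueChar
  exact CharP.char_is_prime (𝓞 K ⧸ v.asIdeal) _

/-- **The `SelmerTriple` reading, unconditional at inert primes**: at a Kolyvagin prime `λ ∈ 𝓛` of a Selmer
triple over an imaginary quadratic `K`, lying over an INERT rational prime (`(ℓ)` prime in `𝓞_K`, `ℓ` the
residue characteristic of `λ`), with `Γ_{K_λ}` acting trivially on `T`:
`Disjoint (t.cond (Sum.inr λ)) (transverseStructure p T jbar (Sum.inr λ))` — the hypothesis `hdisj` of
`SelmerStructureModifyOnePlaceProofs.localization_eq_zero_of_mem_selmerGroup_modify_insert` DISCHARGED.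
[cite: Howard2004HeegnerKolyvagin, Prop. 1.1.9, §1.2, Def. 1.2.2 (arXiv:1202.6340 p. 6)]
[cite: GrossLMS1991, §3 (proof of Prop. 3.7 (2))] -/
theorem SelmerTriple.disjoint_cond_transverseStructure_of_isImaginaryQuadratic (hK : IsImaginaryQuadratic K)
    {ρ : DiscreteGaloisModule K M} (t : SelmerTriple p ρ) (jbar : AlgebraicClosure K →+* ℂ)
    {v : HeightOneSpectrum (𝓞 K)} (hv : v ∈ t.primes)
    (hinert : (Ideal.span {((residueChar v : ℕ) : 𝓞 K)}).IsPrime)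
    (htriv : ∀ (g : absoluteGaloisGroup (v.adicCompletion K)) (x : M), GaloisRep.toLocal v ρ g x = x) :
    Disjoint (t.cond (Sum.inr v)) (transverseStructure p ρ jbar (Sum.inr v)) := by
  obtain ⟨φ, hφ, hφΛ⟩ := exists_isFrobPow_one_and_inv_mul_mem_localRingClassSubgroup hK jbar
    (residueChar_prime v) hinert (natCast_residueChar_mem v)
  exact SelmerTriple.disjoint_cond_transverseStructure_of_isFrobPow p t jbar hv htriv hφ hφΛ

end Disjoint

end Literature.NumberTheory.GaloisCohomology.Howard2004

end
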